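import Literature.Computability.Cryptography.OracleAdversaryCoinPrefix
import HarnessLib

/-!
# A polynomial-time oracle computation reading explicit coins is a PPT oracle adversary

`OracleAdversaryFPRel.lean` turns a PPT oracle adversary `𝒜` (transcript model of
`OracleGames.lean`) into the `FP^O` function `⟨w, s⟩ ↦ out_𝒜(w; s)` of input and coins
(`OracleAdversary.clockedRun_mem_FPRel`). This file is the converse direction, the way reductions
are usually WRITTEN: first a deterministic polynomial-time oracle computation `h ∈ FP^O` of
`⟨input, coins⟩` (assembled from `FP` bricks, truth-table / adaptive oracle transducers
`ttFn`/`adFn`, and the closure `FP^{FP^O} ⊆ FP^O`), then "run it on uniformly random coins of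
polynomial length `c(|w|)`":

* **`exists_ppt_outputPMF_of_mem_FPRel`** — for `h ∈ FPRel O` and a polynomial `c` there is a PPT
  oracle adversary with coin budget `c` whose output law on `w`, with THIS oracle `O`, is the
  push-forward of `U_{c(|w|)}` under `r ↦ some (h ⟨w, r⟩)` (the machine of `h` itself, with the round
  budget `q(|⟨w, r⟩|)`, `|⟨w, r⟩| = 2|w| + 2 + c(|w|)`; it never times out);
* `exists_ppt_toReal_toOuterMeasure_of_mem_FPRel` — the same with the probability of every event
  written as a uniform average of an indicator over the coins (`uniformAvg`).

(The adversary depends on `O` through the machine witnessing `h ∈ FP^O`; for an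
oracle-independent machine use `OracleAdversary.precomp` / `withCoinPrefix` on a given adversary.)

## References

* S. Arora, B. Barak, *Computational Complexity: A Modern Approach*, CUP 2009, Def. 7.1 with §3.4
  (a probabilistic machine is a deterministic machine reading a random tape), §17.2 (`FP` with an
  oracle).
* O. Goldreich, *Foundations of Cryptography I*, CUP 2001, §3.6, Def. 3.6.4 (PPT oracle machines).
-/

noncomputable section

namespace Literature.Computability.Cryptography

open _root_.Computability Complexity

/-- The probability of an event under the push-forward of `U_n` is the uniform average of its
indicator. [cite: AroraBarakCC2009, Def. 7.1 (probability over the random tape as a fraction of tapes)] -/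
theorem toReal_toOuterMeasure_map_uniformBits {γ : Type} (n : ℕ) (f : List Bool → γ) (S : Set γ)
    [DecidablePred (· ∈ S)] :
    (((uniformBits n).map f).toOuterMeasure S).toReal = uniformAvg n (fun c => if f c ∈ S then 1 else 0) := by
  rw [PMF.map, toReal_toOuterMeasure_bind_uniformBits]
  unfold uniformAvg
  congr 1
  refine Finset.sum_congr rfl fun v _ => ?_
  simp only [Function.comp_apply, PMF.toOuterMeasure_pure_apply]
  split_ifs <;> simp

/-- **A polynomial-time oracle computation on explicit coins is a PPT oracle adversary.** For
`h ∈ FP^O` (a function of `⟨input, coins⟩`) and a polynomial coin budget `c` there is a PPT oracle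
adversary `𝒜` with `𝒜.coins = c` such that, with the oracle `O`, the output law of `𝒜` on every
input `w` is the law of `some (h ⟨w, r⟩)` for `r ← U_{c(|w|)}`: the machine witnessing `h ∈ FP^O`, run
for its own round budget at the input length `|⟨w, r⟩| = 2|w| + 2 + c(|w|)`, so that no run times out.
[cite: AroraBarakCC2009, Def. 7.1 with §3.4 and §17.2] [cite: Goldreich2001, §3.6 Def. 3.6.4] -/
theorem exists_ppt_outputPMF_of_mem_FPRel {O : Oracle} {h : List Bool → List Bool} (hh : h ∈ FPRel O)
    (c : Polynomial ℕ) :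
    ∃ 𝒜 : OracleAdversary (List Bool), 𝒜.IsPPT (encodingList Bool) ∧ 𝒜.coins = c ∧
      ∀ w : List Bool, 𝒜.outputPMF O w =
        (PMF.uniformOfFintype (List.Vector Bool (c.eval w.length))).map fun r => some (h (boolPair w r.toList)) := by
  obtain ⟨M, hM, q, hq⟩ := hh
  refine ⟨⟨M, c, q.comp (2 * Polynomial.X + 2 + c)⟩, hM, rfl, fun w => ?_⟩
  rw [OracleAdversary.outputPMF_eq_map]
  refine congrArg (fun f => PMF.map f (PMF.uniformOfFintype (List.Vector Bool (c.eval w.length))))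
    (funext fun r => ?_)
  have hlen : (boolPair w r.toList).length = (2 * Polynomial.X + 2 + c).eval w.length := by
    simp [length_boolPair]
  have hrun := (hq (boolPair w r.toList)).1
  rw [hlen] at hrun
  simpa [Polynomial.eval_comp] using hrun

/-- **The same, for events**: the probability that the adversary's output lies in `S` is the fraction
of coin strings `r ∈ {0,1}^{c(|w|)}` with `some (h ⟨w, r⟩) ∈ S`. [cite: AroraBarakCC2009, Def. 7.1 with §3.4 and §17.2] -/
theorem exists_ppt_toReal_toOuterMeasure_of_mem_FPRel {O : Oracle} {h : List Bool → List Bool}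
    (hh : h ∈ FPRel O) (c : Polynomial ℕ) :
    ∃ 𝒜 : OracleAdversary (List Bool), 𝒜.IsPPT (encodingList Bool) ∧ 𝒜.coins = c ∧
      (∀ w : List Bool, 𝒜.outputPMF O w =
        (PMF.uniformOfFintype (List.Vector Bool (c.eval w.length))).map fun r => some (h (boolPair w r.toList))) ∧
      ∀ (w : List Bool) (S : Set (Option (List Bool))) [DecidablePred (· ∈ S)],
        ((𝒜.outputPMF O w).toOuterMeasure S).toReal =
          uniformAvg (c.eval w.length) (fun r => if some (h (boolPair w r)) ∈ S then 1 else 0) := by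
  obtain ⟨𝒜, h𝒜, hc, hlaw⟩ := exists_ppt_outputPMF_of_mem_FPRel hh c
  refine ⟨𝒜, h𝒜, hc, hlaw, fun w S _ => ?_⟩
  rw [hlaw]
  have hmap : (PMF.uniformOfFintype (List.Vector Bool (c.eval w.length))).map
      (fun r => some (h (boolPair w r.toList))) =
      (uniformBits (c.eval w.length)).map fun r => some (h (boolPair w r)) := by
    rw [uniformBits, PMF.map_comp]
    rfl
  rw [hmap, toReal_toOuterMeasure_map_uniformBits]

end Literature.Computability.Cryptography

end
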